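import Summits.AtomisticToContinuum.Crystallization.Theorems.HullExactificationCascadeHullGoodEverywhereCore
import Summits.AtomisticToContinuum.Crystallization.Theorems.HullExactificationCascadeHullGoodEverywhereDense
import Summits.AtomisticToContinuum.Crystallization.Theorems.HullExactificationCascadeHullGoodEverywhereBonded
import Summits.AtomisticToContinuum.Crystallization.Theorems.PhononSlackCertificatesHullBridgeWindows
import Literature.MathematicalPhysics.StatisticalMechanics.LocalLimitOfGroundStates

/-!
# `HullGoodEverywhere` — item D of route `HullExactificationCascade` (stmt-AtomisticToContinuum-12089)

EXACTIFICATION no. 1: if the `1/20`-defect fraction of a sequence of Lennard-Jones ground states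
`x N` tends to `0`, some hull element `S` (local limit of translates `x (φ j) + τ j`, two-sided
`ε`-matching on every ball, eventually in `j`) is `δ`-separated, contains `0`, is EVERYWHERE
`1/20`-good and relatively dense.

Assembly of the sibling files: clean centres by pigeonhole (`hb_exists_far_from`: the
`k`-neighbourhoods of the `o(N)` defective particles cannot cover a `δ`-separated configuration),
diagonal choice of radii (`Filter.extraction_forall_of_eventually`), recentring at the clean centres,
compactness of uniformly discrete point sets (`exists_subseq_forall_eventually_ballMatch`), passage
of goodness to the limit pattern by pattern (`hge_patternGood_of_limit`, with the scale bounded by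
the bond radius of `hge_exists_bond_radius`), and relative denseness (`hge_relDense`).
-/

noncomputable section

namespace Summit.AtomisticToContinuum.Crystallization.Theorems

open Summit.AtomisticToContinuum.Crystallization.Theses.HullExactificationCascade
open Literature.MathematicalPhysics.StatisticalMechanics Literature.Geometry.DiscreteGeometry
open Filter Topology Metric

/-- A good particle of a separated, bonded configuration is `PatternGood` (fcc or hcp) with scale
at most the bond radius, also after translating the configuration. [folklore] -/
theorem hge_patternGood_particle {N : ℕ} {x : Fin N → EuclideanSpace ℝ (Fin 3)} {δ R₀ : ℝ}
    (hδ : 0 < δ) (hinj : Function.Injective x) (hsep : ∀ i j, i ≠ j → δ ≤ dist (x i) (x j))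
    (hbond : ∀ i j : Fin N, j ≠ i → ∃ k : Fin N, k ≠ i ∧ dist (x i) (x k) ≤ R₀) {j : Fin N}
    (hg : SiteGood (Set.range x) (x j)) (c : EuclideanSpace ℝ (Fin 3)) :
    PatternGood fccKissingPattern R₀ (Set.range fun i => x i + c) (x j + c) ∨
      PatternGood hcpKissingPattern R₀ (Set.range fun i => x i + c) (x j + c) := by
  have hsepS : ∀ p ∈ Set.range x, ∀ q ∈ Set.range x, p ≠ q → δ ≤ dist p q := by
    rintro _ ⟨i, rfl⟩ _ ⟨i', rfl⟩ hne
    exact hsep i i' fun h => hne (h ▸ rfl)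
  have hyS : x j ∈ Set.range x := Set.mem_range_self j
  obtain ⟨⟨hf1, hfne⟩, ⟨hh1, hhne⟩⟩ := hge_patterns_unit_nonempty
  have hg' := (siteGood_iff_patternGood le_rfl).1 hg
  -- a good particle has another particle
  have hother : ∃ j', j' ≠ j := by
    rcases hg' with h | h
    · obtain ⟨d, A, q, -, -, -, hq, -⟩ := h.exists_data hδ hf1 hfne hsepS hyS
      obtain ⟨v₀, hv₀⟩ := id hfne
      obtain ⟨j', hj'⟩ := (hq ⟨v₀, hv₀⟩).1
      exact ⟨j', fun h => (hq ⟨v₀, hv₀⟩).2.1 (by rw [← hj', h])⟩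
    · obtain ⟨d, A, q, -, -, -, hq, -⟩ := h.exists_data hδ hh1 hhne hsepS hyS
      obtain ⟨v₀, hv₀⟩ := id hhne
      obtain ⟨j', hj'⟩ := (hq ⟨v₀, hv₀⟩).1
      exact ⟨j', fun h => (hq ⟨v₀, hv₀⟩).2.1 (by rw [← hj', h])⟩
  obtain ⟨j', hj'⟩ := hother
  obtain ⟨k, hkj, hk⟩ := hbond j j' hj'
  have hb : ∃ z ∈ Set.range x, z ≠ x j ∧ dist z (x j) ≤ R₀ :=
    ⟨x k, Set.mem_range_self k, fun h => hkj (hinj h), by rwa [dist_comm]⟩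
  have hPG := hg.patternGood hb
  rw [hge_range_add_const]
  rcases hPG with h | h
  · exact Or.inl (h.translate hδ hf1 hfne hsepS hyS c)
  · exact Or.inr (h.translate hδ hh1 hhne hsepS hyS c)

/-- Eventually `A ∧ (B ∨ C)` gives frequently `A ∧ B` or frequently `A ∧ C`. [folklore] -/
theorem hge_frequently_or {A B C : ℕ → Prop} (h : ∀ᶠ k in atTop, A k ∧ (B k ∨ C k)) :
    (∃ᶠ k in atTop, A k ∧ B k) ∨ (∃ᶠ k in atTop, A k ∧ C k) := by
  by_contra hcon
  rw [not_or, Filter.not_frequently, Filter.not_frequently] at hcon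
  obtain ⟨k, hk, hk1, hk2⟩ := (h.and (hcon.1.and hcon.2)).exists
  rcases hk.2 with hb | hc
  · exact hk1 ⟨hk.1, hb⟩
  · exact hk2 ⟨hk.1, hc⟩

/-- **Item D (`HullGoodEverywhere`) of route `HullExactificationCascade`.** If the `1/20`-defect
fraction of a sequence of Lennard-Jones ground states tends to `0`, some local limit of translates
along a subsequence is `δ`-separated, contains `0`, is everywhere `1/20`-good and relatively dense.
[folklore] -/
theorem hullGoodEverywhere_proof : HullGoodEverywhere := by
  rw [hullGoodEverywhere_iff]
  intro x hx hbad
  classical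
  obtain ⟨δ, hδ, hsepall⟩ := LennardJonesMinimalDistance_holds
  obtain ⟨R₀, hR₀, hbond⟩ := hge_exists_bond_radius
  -- Step 1: clean centres of every radius `k`, eventually in `N`
  have hclean : ∀ k : ℕ, ∀ᶠ N in atTop, ∃ i : Fin N, ∀ j : Fin N,
      dist (x N j) (x N i) ≤ k → SiteGood (Set.range (x N)) (x N j) := by
    intro k
    set M : ℝ := (2 * (k : ℝ) / δ + 1) ^ 3 with hM
    have hM0 : 0 < M := by positivity
    have ht := hbad.const_mul M
    rw [mul_zero] at ht
    filter_upwards [ht.eventually_lt_const zero_lt_one, eventually_gt_atTop 0] with N hN1 hN0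
    have hNpos : (0 : ℝ) < N := by exact_mod_cast hN0
    set D : Finset (Fin N) := Finset.univ.filter fun i => ¬ SiteGood (Set.range (x N)) (x N i)
      with hD
    have hcardD : (D.card : ℝ) = Nat.card {i : Fin N // ¬ SiteGood (Set.range (x N)) (x N i)} := by
      rw [Nat.card_eq_fintype_card, Fintype.card_subtype]
    have hlt : (D.card : ℝ) * (2 * (k : ℝ) / δ + 1) ^ 3 < N := by
      rw [hcardD, ← hM]
      rw [← mul_div_assoc, mul_comm] at hN1
      rwa [div_lt_iff₀ hNpos, one_mul] at hN1
    obtain ⟨i, hi⟩ := hb_exists_far_from (x N) hδ (Nat.cast_nonneg k) (hsepall N (x N) (hx N)) D hlt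
    refine ⟨i, fun j hj => ?_⟩
    by_contra hbadj
    exact hi j hj (Finset.mem_filter.2 ⟨Finset.mem_univ _, hbadj⟩)
  -- Step 2: diagonal choice of radii and recentring
  obtain ⟨φ₀, hφ₀, hcen⟩ := extraction_forall_of_eventually hclean
  choose ic hic using hcen
  set c : ℕ → EuclideanSpace ℝ (Fin 3) := fun k => -x (φ₀ k) (ic k) with hc
  set Y : ℕ → Set (EuclideanSpace ℝ (Fin 3)) := fun k => Set.range fun j => x (φ₀ k) j + c k
    with hY
  have hYsep : ∀ k, ∀ p ∈ Y k, ∀ q ∈ Y k, p ≠ q → δ ≤ dist p q := by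
    intro k
    rintro _ ⟨j, rfl⟩ _ ⟨j', rfl⟩ hne
    rw [dist_add_right]
    exact hsepall _ _ (hx _) j j' fun h => hne (by simp [h])
  -- Step 3: compactness
  obtain ⟨φ₁, S, hφ₁, hSsep, hlim⟩ := exists_subseq_forall_eventually_ballMatch hδ Y hYsep
  have hYsepφ : ∀ k, ∀ p ∈ Y (φ₁ k), ∀ q ∈ Y (φ₁ k), p ≠ q → δ ≤ dist p q := fun k => hYsep (φ₁ k)
  -- `0 ∈ S`
  have h0Y : ∀ k, (0 : EuclideanSpace ℝ (Fin 3)) ∈ Y k := fun k => ⟨ic k, by simp [hc]⟩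
  have h0S : (0 : EuclideanSpace ℝ (Fin 3)) ∈ S :=
    hge_mem_of_tendsto hδ hSsep hlim (Eventually.of_forall fun k => h0Y (φ₁ k)) tendsto_const_nhds
  -- Step 4: every point of `S` is good with scale `≤ R₀`
  have hgoodS : ∀ y ∈ S, PatternGood fccKissingPattern R₀ S y ∨ PatternGood hcpKissingPattern R₀ S y := by
    intro y hyS
    obtain ⟨hpY, hpy⟩ := hge_exists_approx hδ hYsepφ hlim hyS
    set p : ℕ → EuclideanSpace ℝ (Fin 3) := fun k => nearPt (Y (φ₁ k)) y with hp
    -- eventually `p k` is a good particle of the recentred configuration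
    have hnorm : ∀ᶠ k in atTop, ‖p k‖ < ‖y‖ + 1 := by
      filter_upwards [Metric.tendsto_nhds.1 hpy 1 one_pos] with k hk
      have := norm_le_norm_add_norm_sub' (p k) y
      rw [← dist_eq_norm] at this
      linarith
    have hk1 : ∀ᶠ k : ℕ in atTop, ‖y‖ + 1 ≤ (k : ℝ) :=
      tendsto_natCast_atTop_atTop.eventually_ge_atTop _
    have hev : ∀ᶠ k in atTop, p k ∈ Y (φ₁ k) ∧
        (PatternGood fccKissingPattern R₀ (Y (φ₁ k)) (p k) ∨
          PatternGood hcpKissingPattern R₀ (Y (φ₁ k)) (p k)) := by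
      filter_upwards [hpY, hnorm, hk1] with k hk hkn hk1
      refine ⟨hk, ?_⟩
      obtain ⟨j, hj⟩ := hk
      have hj' : x (φ₀ (φ₁ k)) j + c (φ₁ k) = p k := hj
      have hdist : dist (x (φ₀ (φ₁ k)) j) (x (φ₀ (φ₁ k)) (ic (φ₁ k))) ≤ (φ₁ k : ℕ) := by
        have e : dist (x (φ₀ (φ₁ k)) j) (x (φ₀ (φ₁ k)) (ic (φ₁ k))) = ‖p k‖ := by
          rw [← hj', dist_eq_norm]
          simp only [hc, sub_eq_add_neg]
        rw [e]
        have hkk : (k : ℝ) ≤ (φ₁ k : ℕ) := by exact_mod_cast hφ₁.id_le k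
        linarith
      have hgood := hic (φ₁ k) j hdist
      have := hge_patternGood_particle hδ (hx _).1 (hsepall _ _ (hx _)) (hbond _ _ (hx _)) hgood
        (c (φ₁ k))
      rw [hj'] at this
      exact this
    -- one pattern frequently; extract and pass to the limit
    obtain ⟨⟨hf1, hfne⟩, ⟨hh1, hhne⟩⟩ := hge_patterns_unit_nonempty
    rcases hge_frequently_or hev with hfr | hfr
    · obtain ⟨ψ, hψ, hψP⟩ := extraction_of_frequently_atTop hfr
      exact Or.inl (hge_patternGood_of_limit hf1 hfne hδ (fun k => hYsepφ (ψ k)) hSsep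
        (fun R ε hε => hψ.tendsto_atTop.eventually (hlim R ε hε)) (fun k => (hψP k).1)
        (hpy.comp hψ.tendsto_atTop) (fun k => (hψP k).2))
    · obtain ⟨ψ, hψ, hψP⟩ := extraction_of_frequently_atTop hfr
      exact Or.inr (hge_patternGood_of_limit hh1 hhne hδ (fun k => hYsepφ (ψ k)) hSsep
        (fun R ε hε => hψ.tendsto_atTop.eventually (hlim R ε hε)) (fun k => (hψP k).1)
        (hpy.comp hψ.tendsto_atTop) (fun k => (hψP k).2))
  -- Step 5: assemble
  refine ⟨S, δ, hδ, hSsep, h0S, ⟨fun j => φ₀ (φ₁ j), hφ₀.comp hφ₁, fun j => c (φ₁ j), ?_⟩,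
    fun y hy => PatternGood.siteGood (hgoodS y hy), hge_relDense hδ hSsep ⟨0, h0S⟩ hgoodS⟩
  intro R ε hε
  filter_upwards [hlim R ε hε] with j hj
  exact (ballMatch_zero_range_iff (fun i => x (φ₀ (φ₁ j)) i + c (φ₁ j)) ε R).1 hj

end Summit.AtomisticToContinuum.Crystallization.Theorems

end
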